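import Mathlib

/-!
# Oriented SDPP gadgets: the confinement inequalities (solo-blind seat, s58)

An *oriented SDPP gadget* in a finite abelian group `G` is a family of pairs of finite sets
`(P s, Q s)`, `s : ι` linearly ordered, together with a set `D ⊆ G`, such that

* `Q s - P s ⊆ D` for every `s` (own differences land in `D`);
* for `s < s'` no element of `Q s - P s'` lies in `D` (upper cross differences avoid `D`);
* each pair has the double product property: `(p, q) ↦ q - p` is injective on `P s × Q s`.

Constant-composition powers of such a gadget satisfy the simultaneous double product property
of Cohn–Kleinberg–Szegedy–Umans (FOCS 2005, Def. 20), so by their Theorem 23 a gadget with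
`∑ s, (|P s| * |Q s|)^(w/2) = |G|^(3/2)` yields `ω ≤ w`; Proposition 24 of that paper is the
two-pair gadget `({0}, G∖{0}), (G∖{0}, {0})` in `ℤ/6`, value `2.4785`.

This file kernel-checks the three elementary *necessary conditions* used by the seat's
threshold computation (no gadget of order `< 33` can have value below `2.4785`):

* `soloSdpp_card_mul_le`      : DPP and `Q - P ⊆ D` give `|P| * |Q| ≤ |D|`;
* `soloSdpp_disjoint_P`       : the `P s` are pairwise disjoint;
* `soloSdpp_sum_card_P_le`    : for any index `s₀`, `∑_{s > s₀} |P s| ≤ |G| - |D|`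
  (all those `P s` sit inside `q - (G ∖ D)` for any `q ∈ Q s₀`).

The symmetric statements for the `Q s` (indices below a given one) follow by applying the
same lemmas to the reversed gadget `(-Q, -P)` with the order reversed; they are not repeated.
-/

namespace Summit.MatrixMultiplication.MatrixMultiplication.Theorems

open Finset

variable {G : Type*} [AddCommGroup G] [DecidableEq G]

/-- DPP for one pair together with `Q - P ⊆ D` forces `|P| * |Q| ≤ |D|`. -/
theorem soloSdpp_card_mul_le (P Q D : Finset G)
    (hD : ∀ p ∈ P, ∀ q ∈ Q, q - p ∈ D)
    (hDPP : ∀ p ∈ P, ∀ p' ∈ P, ∀ q ∈ Q, ∀ q' ∈ Q, q - p = q' - p' → p = p' ∧ q = q') :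
    P.card * Q.card ≤ D.card := by
  classical
  rw [← Finset.card_product]
  have hinj : Set.InjOn (fun x : G × G => x.2 - x.1) ↑(P ×ˢ Q) := by
    intro x hx y hy hxy
    rw [Finset.coe_product, Set.mem_prod] at hx hy
    obtain ⟨h1, h2⟩ := hDPP x.1 hx.1 y.1 hy.1 x.2 hx.2 y.2 hy.2 hxy
    exact Prod.ext h1 h2
  calc (P ×ˢ Q).card = ((P ×ˢ Q).image (fun x : G × G => x.2 - x.1)).card :=
        (Finset.card_image_of_injOn hinj).symm
    _ ≤ D.card := by
        refine Finset.card_le_card ?_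
        intro d hd
        rw [Finset.mem_image] at hd
        obtain ⟨x, hx, rfl⟩ := hd
        rw [Finset.mem_product] at hx
        exact hD x.1 hx.1 x.2 hx.2

variable {ι : Type*} [LinearOrder ι]

omit [DecidableEq G] in
/-- In an oriented gadget the sets `P s` are pairwise disjoint. -/
theorem soloSdpp_disjoint_P (P Q : ι → Finset G) (D : Finset G)
    (hown : ∀ s, ∀ p ∈ P s, ∀ q ∈ Q s, q - p ∈ D)
    (hcross : ∀ s s', s < s' → ∀ p ∈ P s', ∀ q ∈ Q s, q - p ∉ D)
    (hne : ∀ s, (Q s).Nonempty) :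
    ∀ s s', s ≠ s' → Disjoint (P s) (P s') := by
  intro s s' hss'
  rw [Finset.disjoint_left]
  intro p hp hp'
  rcases lt_or_gt_of_ne hss' with h | h
  · obtain ⟨q, hq⟩ := hne s
    exact hcross s s' h p hp' q hq (hown s p hp q hq)
  · obtain ⟨q, hq⟩ := hne s'
    exact hcross s' s h p hp q hq (hown s' p hp' q hq)

/-- Confinement: all `P s` with `s > s₀` lie in `q - (G ∖ D)` for any `q ∈ Q s₀`, and they are
pairwise disjoint, hence `∑_{s > s₀} |P s| ≤ |G| - |D|`. -/
theorem soloSdpp_sum_card_P_le [Fintype G] (S : Finset ι) (P Q : ι → Finset G) (D : Finset G)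
    (hown : ∀ s, ∀ p ∈ P s, ∀ q ∈ Q s, q - p ∈ D)
    (hcross : ∀ s s', s < s' → ∀ p ∈ P s', ∀ q ∈ Q s, q - p ∉ D)
    (hne : ∀ s, (Q s).Nonempty) (s₀ : ι) (hS : ∀ s ∈ S, s₀ < s) :
    ∑ s ∈ S, (P s).card ≤ Fintype.card G - D.card := by
  classical
  obtain ⟨q, hq⟩ := hne s₀
  have hdisj := soloSdpp_disjoint_P P Q D hown hcross hne
  have hunion : (S.biUnion P).card = ∑ s ∈ S, (P s).card := by
    refine Finset.card_biUnion ?_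
    intro x _ y _ hxy
    exact hdisj x y hxy
  have hsub : S.biUnion P ⊆ (Finset.univ \ D).image (fun e : G => q - e) := by
    intro p hp
    rw [Finset.mem_biUnion] at hp
    obtain ⟨s, hs, hps⟩ := hp
    rw [Finset.mem_image]
    refine ⟨q - p, ?_, ?_⟩
    · rw [Finset.mem_sdiff]
      exact ⟨Finset.mem_univ _, hcross s₀ s (hS s hs) p hps q hq⟩
    · abel
  calc ∑ s ∈ S, (P s).card = (S.biUnion P).card := hunion.symm
    _ ≤ ((Finset.univ \ D).image (fun e : G => q - e)).card := Finset.card_le_card hsub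
    _ ≤ (Finset.univ \ D).card := Finset.card_image_le
    _ = Fintype.card G - D.card := Finset.card_univ_sdiff D

end Summit.MatrixMultiplication.MatrixMultiplication.Theorems
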